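import Literature.MathematicalPhysics.QuantumFieldTheory.Balaban1983to89.Node00.BgGaugeLetterOfRecord
import Literature.MathematicalPhysics.QuantumFieldTheory.Balaban1983to89.B15AveragingAnalytic
import Literature.MathematicalPhysics.QuantumFieldTheory.Balaban1983to89.B8Thm2LogB
import Literature.MathematicalPhysics.QuantumFieldTheory.Balaban1983to89.B11Eq80Current
import Literature.MathematicalPhysics.QuantumFieldTheory.Balaban1983to89.B15Claim189UnitTestAtRecord
import HarnessLib

/-!
# The record's NONLINEAR CONSTRAINT LETTERS `B(V)` of (20) and `C_k` of (44)∕(49)–(50), holomorphic edition (M2 file 3e′)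

statement-level skeleton of published definitions with citation tags; nothing here is a claim about the Yang–Mills mass gap
(cell `pub-ymgap`, unit `pub-ymgap-node00-def-Y` g37; Node00 = the record `(F : T4Family, SU(N), avOfRecord)`; [B11] = [Balaban1985Variational],
[B8] = [Balaban1985RegularSpaces], [B9] = [Balaban1985BackgroundPropagators], [B7] = [Balaban1985Averaging], [RG1] = [Balaban1987RG1]).

THE PRINTED TEXT ([B11], held `paper:balaban1985-cmp102-variational-background`, journal page = PDF page + 276).  p. 280 (15) «U = U′U₀»; p. 281 (19)
«A = (1/iη) log U₁», (20) «Q_j(U₀, ηA) = B on Λ_j, j = 0, 1, …, k, where B is given by the formulas (1.31) in [6], hence |B| < 2dLC₁ε₁» ([6] = [B8],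
(1.31) first line: «B_b = (1/i) log V′_b», «V(Ū₀ʲ)⁻¹ = V′»); p. 285 «The Proposition 4 of [4] implies  Q_j(L^jηA) = L^jηQ_jA + C_j(L^jηA),
|C_j(L^jηA)| ≤ C₂(L^jη)²|A|².  (44)», «We will construct the linearizing transformation in the form  A = A′ − HD(A′),  (47)», «C_j(L^jηA′ − L^jηHD(A′))
= D(A′) on Λ_j.  (49)  Thus the function D(A′) is a fixed point of the transformation  X → C_j(L^jηA′ − L^jηHX) on Λ_j, j = 0, 1, …, k.  (50)  We consider
configurations A′, X with values in the complexified Lie algebra 𝔤ᶜ …  (51)»; p. 293 (103) «𝔄 = H₁B»; Sect. G p. 307 (analyticity in the complex fields).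

WHAT IS HERE (additive to files 3a–3d ✓; nothing landed is changed; every new letter is a FORMULA over landed letters).
* §1 (generic torus `P`, any `N`) `expOver U₀ X := (b ↦ exp(i X(b)) · U₀(b))` — the chart (15)∕(19) «U = U′U₀, U′ = exp(iηA′)» as a COMPLEX MATRIX field
  (`X = ηA′` may be `𝔤ᶜ`-valued, (51)), entire in `X` (`analyticAt_expOver`); `logOver W Z := (c ↦ (1/i) log(Z(c) · W(c)⋆))` — the log-coordinate of a
  level-`k` field `Z` over a unitary-valued field `W` (`W⋆ = W⁻¹` there), print's «(1/i) log V′, V′ = V(Ū₀ʲ)⁻¹», with `log` = the tree's power series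
  `MatrixLog.mlog` about `1`; on `SU(N)`-valued fields it IS lit's (1.31) letter `B8Thm2LogB.Bint` (`logOver_coeField_apply_eq_Bint`, `rfl`-grade), so lit's
  (1.37)∕(20) estimates `B8Thm2LogB.norm_Bint_le_div` ∕ `ineq137_interior` apply BY NAME.
* §2 (the record `F.P K`, level `k`, background `U₀`, `Ū^k := Averaging.iter (avOfRecord F N K) k`):
  `BOfRecord F N K k U₀ levB V : NegSize L η_k levB 0 M_N(ℂ)` = «B = (1/i) log(V·(Ū^k U₀)⁻¹)» of (20) read into the `|·|_{(−0)}` size of (115)-type (the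
  domain of file 3c's `H1OfRecordAtBgFlat`); `BOfRecord_self : B(Ū^k U₀) = 0`; the (20) bound «|B| < 2dLα₁» from «|V(Ū^kU₀)⁻¹ − 1| ≤ α₁» VERBATIM from lit
  (`norm_BOfRecord_lt`, print's `α₁ = C₁ε₁`); `frakAOfRecordAtBgFlat … V := H1OfRecordAtBgFlat … (BOfRecord … V)` = (103) «𝔄 = H₁B» at the record's letters.
* §3 ★ `COfRecord F N K k Ω U₀ levB : Space115Lit F N K k Ω U₀ → NegSize L η_k levB 0 M_N(ℂ)`, the record's `C_k` of (44):
  `C(A′)(c) = (1/i) log( Ū^k_h(exp(iη_k A′)·U₀)(c) · (Ū^k U₀)(c)⋆ ) − (Q_k(U₀)A′)(c)`, where `Ū^k_h = B15AveragingHolomorphic.iterMh k` is the HOLOMORPHIC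
  matrix extension of the (0.4) averaging of record (adjugates on backward steps; `= ↑(Ū^k U)` on guarded `SU(N)` fields, `coeField_avgFamily_eq_iterMh`),
  `A′ ↦ (b ↦ A′(b))` is file 3a's presentation `evLit`, and `Q_k(U₀) = qCplxOp k U₀` is file 3b's linearised averaging ([B9] (3.13), with the `L^{-k}`
  of file 3b's `rightTrivNorm`; since `η_k = L^{-k}` (`Setup`'s `Params.eta`), `A′ ↦ Q_k(U₀)A′` is the ℂ-linear part at `A′ = 0` of the first summand —
  print's `L^jηQ_j` of (44) at `j = k` in the record's units; this identification is DISPLAYED, not proved, see HONEST LABELS (1)).  DICTIONARY WITH (44)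
  at `j = k`: `X = η_kA′`, `C_k(X) = Q_k(U₀, X) − L^kη_k·Q_k(U₀)A′`, `L^kη_k = 1`; with (47)–(50): `A = A′ − HD(A′)` is lit's `B11Eq80Current.T47 H C εC A′`,
  `HD(A′)` is `B11Eq80Current.Emap H C εC A′` and `D(A′) = C(A′ − HD(A′))` the fixed point of (50) (`B11Eq174Chart.solA` inside `Emap`), once
  `H := H1OfRecordAtBgFlat …` (file 3c) and `C := COfRecord …` are substituted (file 3f′).
  PROVED here: `COfRecord_zero : C(0) = 0` under the small-field guard of `U₀` below `k`; ★ `analyticAt_COfRecord` — `C` is ℂ-ANALYTIC at every `A′` whose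
  chart field has its (0.4) loop matrices in the polydisc `‖W − 1‖ < 1` below `k` and its relative average `Z(c)(Ū^kU₀)(c)⋆` in the log-disc `‖· − 1‖ < 1`
  (Sect. G's analyticity, from `B15AveragingAnalytic.analyticAt_iterMh_of_polydisc` + `MatrixLog.analyticAt_mlog` + `NormedSpace.exp_analytic`); hence
  ★ `analyticAt_COfRecord_zero` (at `A′ = 0` under the guard), `eventually_analyticAt_COfRecord_zero`, and `exists_differentiableOn_COfRecord` — SOME ball
  `{‖A′‖ < r}` on which `C` is ℂ-differentiable (the `differentiableOn` field of lit's `B11Prop6Scheme.Prop4Hyp` ∕ `B11Eq80Current.Regime`, radius not computed).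
* §4 `C2OfRecord … := B11Eq80Current.quadPart (COfRecord …)` — print's `C⁽²⁾(A′) = ½·D²C(0)(A′,A′)` of (56)∕(78) BY NAME (the letter lit's `E3`∕`W80` and
  [B9]'s (3.128) `Δ⁽²⁾_π`-datum consume; `C2OfRecord_zero`), and the letters AT THE UNIT BACKGROUND `U₀ = 1` (E1: `expOver_one`, `BOfRecord_one_apply`
  «B(V) = (1/i) log V», `COfRecord_one_apply`; E2, hypotheses inhabited at `(U₀, V) = (1, 1)`: `smallBelow_avOfRecord_one` — the guard holds at `1`, from lit's
  `B15Claim189UnitTestAtRecord.iter_avOfRecord_one` + `T3DescentFibreTower.small_one` — whence `BOfRecord_one_one : B(1) = 0`, `frakAOfRecordAtBgFlat_one_one`,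
  `COfRecord_one_zero`, `analyticAt_COfRecord_one_zero`, `exists_differentiableOn_COfRecord_one` UNCONDITIONALLY).

HONEST LABELS.  (1) NOT asserted here (tokens of the successor files ∕ the cell's N07 seats): the (44) estimate `|C(A′)| ≤ C₂|A′|²` with a constant (lit's
`Prop4Hyp.bound`), the identification `fderiv ℂ C 0 = 0` (equivalently: the derivative at `0` of the first summand of `C` is `qCplxOp k U₀ ∘ evLit`, [B9] (3.13)),
the equality (20) `Q_k(U₀, ηA) = B` for the minimiser, print's (56) formula for `C⁽²⁾`, and any radius.  (2) JUNK VALUES, located: off the log-disc `mlog` is the (convergent or not) power series'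
value and off the guard `iterMh` uses adjugates for inverses — `COfRecord` is a total function whose meaning is claimed ONLY where the displayed hypotheses hold;
no theorem here evaluates it elsewhere.  (3) WHY `iterMh` and not n07-e's `iterM`: `iterM` inverts by `star` (real-analytic, not holomorphic), so `fderiv ℂ`
through it would be silent junk; the two agree on guarded `SU(N)` fields (`B15AveragingHolomorphic.iterMh_coeField_eq_iterM`).  (4) RIGHT trivialisation
`Z·W⋆` (as file 3b's `rightTrivNorm` and print's `V(Ū^kU₀)⁻¹`); the nearest tree analogue, `B15Prop1DatumCoordinates` (the N12 datum's log-coordinates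
`(1/i) log(W⋆·Ū^j_h)` in Pauli coordinates, LEFT-trivialised, `SU(2)`), and the `ℤ^d`-carrier remainder `B11Eq44Concrete.Cmap` of [B7] Prop. 4 are CITED, not
restated: different carriers ∕ groups.  (5) COUNT∕K unchanged; finite `𝕋⁴` at fixed `ε`; nothing continuum ∕ OS ∕ Clay; no instance, no notation, no `sorry`.
-/

noncomputable section

open scoped Matrix Matrix.Norms.L2Operator InnerProductSpace ComplexConjugate Topology

namespace Literature.MathematicalPhysics.QuantumFieldTheory.Balaban1983to89.Node00

open T4Continuum BlockAveraging
open NormedSpace (exp)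
open MatrixLog (mlog mlog_one analyticAt_mlog)
open B15AveragingHolomorphic (iterMh loopMh loopMh_coeField coeField_iter_eq_iterMh coeField_avgFamily_eq_iterMh)
open B15AveragingAnalytic (analyticAt_iterMh_of_polydisc)
open B15DeterminingSets (avgFamily)
open B11Eq115Space (NegSize NegSup levWeight levWeight_apply)
open B8Thm2LogB (Bint)

/-! ## §1. The chart over a background and the log-coordinate over a unitary field (generic torus) -/

section Generic

variable {P : Params} {N : ℕ} {k : ℕ}

/-- **THE CHART (15)∕(19) AS A COMPLEX MATRIX FIELD**: `expOver U₀ X = (b ↦ exp(i X(b)) · U₀(b))` («U = U′U₀, U′ = exp(iηA′)», `X = ηA′`, `X` may be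
`𝔤ᶜ`-valued as in (51)). [cite: Balaban1985Variational, (15) p.280, (19) p.281, (51) p.286] -/
def expOver (U₀ : GaugeField P 0 (SU N)) (X : PBond P 0 → Matrix (Fin N) (Fin N) ℂ) : PBond P 0 → Matrix (Fin N) (Fin N) ℂ :=
  fun b => exp (Complex.I • X b) * (U₀ b : Matrix (Fin N) (Fin N) ℂ)

/-- Unfolding of `expOver` (`rfl`). [cite: Balaban1985Variational, (15) p.280 (bookkeeping)] -/
theorem expOver_apply (U₀ : GaugeField P 0 (SU N)) (X : PBond P 0 → Matrix (Fin N) (Fin N) ℂ) (b : PBond P 0) :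
    expOver U₀ X b = exp (Complex.I • X b) * (U₀ b : Matrix (Fin N) (Fin N) ℂ) := rfl

/-- At `X = 0` the chart sits at the background: `expOver U₀ 0 = ↑U₀`. [cite: Balaban1985Variational, (15) p.280 (bookkeeping)] -/
theorem expOver_zero (U₀ : GaugeField P 0 (SU N)) : expOver U₀ 0 = coeField U₀ := by
  funext b
  rw [expOver_apply, Pi.zero_apply, smul_zero, NormedSpace.exp_zero, one_mul, coeField_apply]

/-- At the unit background the chart is the plain exponential `X ↦ (b ↦ exp(iX(b)))` (E1). [cite: Balaban1985Variational, (15) p.280, (19) p.281] -/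
theorem expOver_one [NeZero N] (X : PBond P 0 → Matrix (Fin N) (Fin N) ℂ) :
    expOver (1 : GaugeField P 0 (SU N)) X = fun b => exp (Complex.I • X b) := by
  funext b
  rw [expOver_apply, show (1 : GaugeField P 0 (SU N)) b = 1 from rfl, OneMemClass.coe_one, mul_one]

/-- **The chart is entire in `X`** (bondwise `exp ∘ (i·evaluation)` times a constant). [cite: Balaban1985Variational, Sect. G p.307, (15) p.280] -/
theorem analyticAt_expOver (U₀ : GaugeField P 0 (SU N)) (X : PBond P 0 → Matrix (Fin N) (Fin N) ℂ) : AnalyticAt ℂ (expOver U₀) X := by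
  change AnalyticAt ℂ (fun Y : PBond P 0 → Matrix (Fin N) (Fin N) ℂ => fun b => exp (Complex.I • Y b) * (U₀ b : Matrix (Fin N) (Fin N) ℂ)) X
  refine analyticAt_pi_iff.2 fun b => ?_
  have hev : AnalyticAt ℂ (fun Y : PBond P 0 → Matrix (Fin N) (Fin N) ℂ => Y b) X :=
    (ContinuousLinearMap.proj (R := ℂ) (φ := fun _ : PBond P 0 => Matrix (Fin N) (Fin N) ℂ) b).analyticAt X
  have hexp : AnalyticAt ℂ (fun Y : PBond P 0 → Matrix (Fin N) (Fin N) ℂ => exp (Complex.I • Y b)) X :=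
    (NormedSpace.exp_analytic (𝕂 := ℂ) _).comp hev.fun_const_smul
  exact hexp.mul analyticAt_const

/-- **THE LOG-COORDINATE OVER A (UNITARY-VALUED) FIELD**: `logOver W Z = (c ↦ (1/i) log(Z(c) · W(c)⋆))` — print's «B = (1/i) log V′, V′ = V(Ū₀ʲ)⁻¹»
((20), [B8] (1.31)), `W⋆ = W⁻¹` on unitary values; `log` = the power series `MatrixLog.mlog` about `1`. [cite: Balaban1985Variational, (20) p.281; Balaban1985RegularSpaces, (1.31) p.82] -/
def logOver (W Z : PBond P k → Matrix (Fin N) (Fin N) ℂ) : PBond P k → Matrix (Fin N) (Fin N) ℂ :=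
  fun c => (Complex.I⁻¹ : ℂ) • mlog (Z c * star (W c))

/-- Unfolding of `logOver` (`rfl`). [cite: Balaban1985Variational, (20) p.281 (bookkeeping)] -/
theorem logOver_apply (W Z : PBond P k → Matrix (Fin N) (Fin N) ℂ) (c : PBond P k) :
    logOver W Z c = (Complex.I⁻¹ : ℂ) • mlog (Z c * star (W c)) := rfl

/-- ★ **On `SU(N)`-valued fields the log-coordinate IS lit's (1.31) letter `B8Thm2LogB.Bint`** at the unit `V(c)·W(c)⁻¹` (so lit's (1.37)∕(20) estimates apply
by name). [cite: Balaban1985RegularSpaces, (1.31) p.82; Balaban1985Variational, (20) p.281] -/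
theorem logOver_coeField_apply_eq_Bint [NeZero N] (W V : GaugeField P k (SU N)) (c : PBond P k) :
    logOver (coeField W) (coeField V) c = Bint (suToUnits N (V c * (W c)⁻¹)) := by
  rw [logOver_apply, Bint, coe_suToUnits, Submonoid.coe_mul, coe_inv_SU, coeField_apply, coeField_apply]

/-- Over itself a unitary-valued field has log-coordinate `0` (`W W⋆ = 1`, `log 1 = 0`). [cite: Balaban1985Variational, (3) p.278, (20) p.281 (bookkeeping)] -/
theorem logOver_coeField_self (W : GaugeField P k (SU N)) : logOver (coeField W) (coeField W) = 0 := by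
  funext c
  rw [logOver_apply, coeField_apply, coe_mul_star_coe_SU, mlog_one, smul_zero, Pi.zero_apply]

/-- **The log-coordinate is ℂ-analytic in `Z` on the log-disc** `‖Z(c)W(c)⋆ − 1‖ < 1` (bondwise `(1/i)·mlog ∘ (right multiplication by W(c)⋆)`).
[cite: Balaban1985Variational, Sect. G p.307; Balaban1985Averaging, (21) p.21] -/
theorem analyticAt_logOver_apply (W : PBond P k → Matrix (Fin N) (Fin N) ℂ) {Z : PBond P k → Matrix (Fin N) (Fin N) ℂ} (c : PBond P k)
    (h : ‖Z c * star (W c) - 1‖ < 1) : AnalyticAt ℂ (fun Y : PBond P k → Matrix (Fin N) (Fin N) ℂ => logOver W Y c) Z := by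
  have hev : AnalyticAt ℂ (fun Y : PBond P k → Matrix (Fin N) (Fin N) ℂ => Y c) Z :=
    (ContinuousLinearMap.proj (R := ℂ) (φ := fun _ : PBond P k => Matrix (Fin N) (Fin N) ℂ) c).analyticAt Z
  have hZ : AnalyticAt ℂ (fun Y : PBond P k → Matrix (Fin N) (Fin N) ℂ => Y c * star (W c)) Z := hev.mul analyticAt_const
  exact ((analyticAt_mlog h).comp_of_eq hZ rfl).fun_const_smul

end Generic

/-! ## §2. The record's `B(V)` of (20) and `𝔄(V) = H₁B` of (103) -/

section Record

variable (F : T4Family) (N : ℕ) [NeZero N] {K : ℕ} (k : ℕ)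

variable (K) in
/-- ★ **`B` OF (20) AT THE RECORD**: `B(V)(c) = (1/i) log( V(c) · (Ū^k U₀)(c)⋆ )`, `Ū^k = Averaging.iter (avOfRecord F N K) k` (the genuine `SU(N)` average,
so `⋆ = ⁻¹`), read into the size `|·|_{(−0)}` of (115)-type on the level-`k` bonds (the domain of file 3c's `H1OfRecordAtBgFlat`). [cite: Balaban1985Variational, (20) p.281, (103) p.293; Balaban1985RegularSpaces, (1.31) p.82] -/
def BOfRecord (U₀ : GaugeField (F.P K) 0 (SU N)) (levB : PBond (F.P K) k → ℕ) (V : GaugeField (F.P K) k (SU N)) :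
    NegSize (F.L : ℝ) ((F.P K).eta k) levB 0 (Matrix (Fin N) (Fin N) ℂ) :=
  (NegSup.equiv _ _).symm (logOver (coeField (Averaging.iter (avOfRecord F N K) k U₀)) (coeField V))

/-- Unfolding of `BOfRecord` at a bond. [cite: Balaban1985Variational, (20) p.281 (bookkeeping)] -/
theorem BOfRecord_apply (U₀ : GaugeField (F.P K) 0 (SU N)) (levB : PBond (F.P K) k → ℕ) (V : GaugeField (F.P K) k (SU N)) (c : PBond (F.P K) k) :
    NegSup.equiv _ _ (BOfRecord F N K k U₀ levB V) c =
      (Complex.I⁻¹ : ℂ) • mlog ((V c : Matrix (Fin N) (Fin N) ℂ) * star (Averaging.iter (avOfRecord F N K) k U₀ c : Matrix (Fin N) (Fin N) ℂ)) := rfl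

/-- `B` at a bond IS lit's (1.31) letter `Bint` at the unit `V(c)·(Ū^kU₀)(c)⁻¹`. [cite: Balaban1985RegularSpaces, (1.31) p.82; Balaban1985Variational, (20) p.281] -/
theorem BOfRecord_apply_eq_Bint (U₀ : GaugeField (F.P K) 0 (SU N)) (levB : PBond (F.P K) k → ℕ) (V : GaugeField (F.P K) k (SU N)) (c : PBond (F.P K) k) :
    NegSup.equiv _ _ (BOfRecord F N K k U₀ levB V) c = Bint (suToUnits N (V c * (Averaging.iter (avOfRecord F N K) k U₀ c)⁻¹)) :=
  logOver_coeField_apply_eq_Bint (Averaging.iter (avOfRecord F N K) k U₀) V c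

/-- **`B(Ū^k U₀) = 0`**: the background's own average satisfies the constraint with `B = 0` ((3) «Ūʲ = V» ⇒ (20) with `V′ = 1`). [cite: Balaban1985Variational, (3) p.278, (20) p.281] -/
theorem BOfRecord_self (U₀ : GaugeField (F.P K) 0 (SU N)) (levB : PBond (F.P K) k → ℕ) :
    BOfRecord F N K k U₀ levB (Averaging.iter (avOfRecord F N K) k U₀) = 0 := by
  rw [BOfRecord, logOver_coeField_self]
  rfl

/-- ★ **THE (20) BOUND AT THE RECORD, VERBATIM FROM LIT's (1.37)**: if `|V(c)(Ū^kU₀)(c)⁻¹ − 1| ≤ α₁` at every level-`k` bond, `0 < α₁`, `dLα₁ ≤ 1/8`, then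
`‖B(V)‖_{(−0)} < 2dLα₁` (print: `α₁ = C₁ε₁`, «hence |B| < 2dLC₁ε₁»). [cite: Balaban1985Variational, (20) p.281, (14) p.280; Balaban1985RegularSpaces, (1.37) p.82] -/
theorem norm_BOfRecord_lt [Fact (0 < (F.L : ℝ))] [Fact (0 < (F.P K).eta k)] (U₀ : GaugeField (F.P K) 0 (SU N)) (levB : PBond (F.P K) k → ℕ)
    (V : GaugeField (F.P K) k (SU N)) {α₁ : ℝ} (hα : 0 < α₁) (hd : 1 ≤ (F.P K).d) (hsmall : ((F.P K).d : ℝ) * (F.P K).L * α₁ ≤ 1 / 8)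
    (hV : ∀ c : PBond (F.P K) k, ‖(V c : Matrix (Fin N) (Fin N) ℂ) * star (Averaging.iter (avOfRecord F N K) k U₀ c : Matrix (Fin N) (Fin N) ℂ) - 1‖ ≤ α₁) :
    ‖BOfRecord F N K k U₀ levB V‖ < 2 * (F.P K).d * (F.P K).L * α₁ := by
  have hd0 : (0 : ℝ) < (F.P K).d := Nat.cast_pos.mpr hd
  have hL0 : (0 : ℝ) < (F.P K).L := Nat.cast_pos.mpr (F.P K).L_pos
  have hr : 0 < 2 * ((F.P K).d : ℝ) * (F.P K).L * α₁ := mul_pos (mul_pos (mul_pos two_pos hd0) hL0) hα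
  refine (NegSup.norm_lt_iff (w := levWeight (F.L : ℝ) ((F.P K).eta k) levB 0) (V := Matrix (Fin N) (Fin N) ℂ) (f := BOfRecord F N K k U₀ levB V) hr).2
    fun c => ?_
  rw [levWeight_apply, pow_zero, one_mul, BOfRecord_apply_eq_Bint]
  refine B8Thm2LogB.ineq137_interior (F.P K).L hd (Nat.succ_le_of_lt (F.P K).L_pos) hα hsmall ?_
  rw [coe_suToUnits, Submonoid.coe_mul, coe_inv_SU]
  exact hV c

variable (Ω : ℕ → Set (Site (F.P K) 0)) (U₀ : GaugeField (F.P K) 0 (SU N))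

variable (K) in
/-- ★ **`𝔄 = H₁B` OF (103) AT THE RECORD** (flat gauge letter): `𝔄(V) = H₁(B(V))` with `H₁ = H1OfRecordAtBgFlat …` of file 3c and `B = BOfRecord`.
[cite: Balaban1985Variational, (103) p.293, (20) p.281, (116) p.295] -/
def frakAOfRecordAtBgFlat [Fact (0 < (F.L : ℝ))] [Fact (0 < (F.P K).eta k)] [Fact (0 < c0Rec F K k)] [Fact (∀ c, 0 < wBRec F K k c)]
    (levB : PBond (F.P K) k → ℕ) (a : ℝ)
    (hpos : ∀ x, x ≠ 0 → 0 < RCLike.re ⟪x, laplaceAOfRecord F N k U₀ (QOfRecord F N k U₀) (QflatOfRecord F N k) a x⟫_ℂ)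
    (hQ : Function.Surjective (QOfRecord F N k U₀)) (V : GaugeField (F.P K) k (SU N)) : Space115Lit F N K k Ω U₀ :=
  H1OfRecordAtBgFlat F N K k Ω U₀ levB a hpos hQ (BOfRecord F N K k U₀ levB V)

/-- Unfolding of `frakAOfRecordAtBgFlat` (`rfl`). [cite: Balaban1985Variational, (103) p.293 (bookkeeping)] -/
theorem frakAOfRecordAtBgFlat_eq [Fact (0 < (F.L : ℝ))] [Fact (0 < (F.P K).eta k)] [Fact (0 < c0Rec F K k)] [Fact (∀ c, 0 < wBRec F K k c)]
    (levB : PBond (F.P K) k → ℕ) (a : ℝ)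
    (hpos : ∀ x, x ≠ 0 → 0 < RCLike.re ⟪x, laplaceAOfRecord F N k U₀ (QOfRecord F N k U₀) (QflatOfRecord F N k) a x⟫_ℂ)
    (hQ : Function.Surjective (QOfRecord F N k U₀)) (V : GaugeField (F.P K) k (SU N)) :
    frakAOfRecordAtBgFlat F N K k Ω U₀ levB a hpos hQ V = H1OfRecordAtBgFlat F N K k Ω U₀ levB a hpos hQ (BOfRecord F N K k U₀ levB V) := rfl

/-- **`𝔄(Ū^k U₀) = 0`** (the background's own average needs no correction: `B = 0`, `H₁` linear). [cite: Balaban1985Variational, (103) p.293, (3) p.278] -/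
theorem frakAOfRecordAtBgFlat_self [Fact (0 < (F.L : ℝ))] [Fact (0 < (F.P K).eta k)] [Fact (0 < c0Rec F K k)] [Fact (∀ c, 0 < wBRec F K k c)]
    (levB : PBond (F.P K) k → ℕ) (a : ℝ)
    (hpos : ∀ x, x ≠ 0 → 0 < RCLike.re ⟪x, laplaceAOfRecord F N k U₀ (QOfRecord F N k U₀) (QflatOfRecord F N k) a x⟫_ℂ)
    (hQ : Function.Surjective (QOfRecord F N k U₀)) :
    frakAOfRecordAtBgFlat F N K k Ω U₀ levB a hpos hQ (Averaging.iter (avOfRecord F N K) k U₀) = 0 := by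
  rw [frakAOfRecordAtBgFlat_eq, BOfRecord_self, map_zero]

/-! ## §3. The record's `C_k` of (44)∕(49)–(50), holomorphic, and its analyticity near `A′ = 0` -/

variable (K) in
/-- ★★ **THE NONLINEAR CONSTRAINT LETTER `C_k` OF (44) AT THE RECORD**:
`C(A′)(c) = (1/i) log( Ū^k_h(exp(iη_kA′)·U₀)(c) · (Ū^kU₀)(c)⋆ ) − (Q_k(U₀)A′)(c)` — the nonlinear average of the chart (15)∕(19) in the log-coordinate (20)
MINUS its linearisation (file 3b's `qCplxOp k U₀`, [B9] (3.13); print's factor `L^kη_k` is `1` at the record, `η_k = L^{-k}`), `Ū^k_h = iterMh k` the holomorphic extension of the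
(0.4) averaging of record, `A′` presented on the record's bonds by `evLit`.  It is the `C` of (49)–(50) «D(A′) = C(A′ − HD(A′))» (the `C`-slot of lit's
`B11Eq80Current.Emap ∕ T47 ∕ W80`).
[cite: Balaban1985Variational, (44) p.285, (49)–(50) p.285, (20) p.281; Balaban1985BackgroundPropagators, (3.13) p.393; Balaban1987RG1, (0.4) p.253] -/
def COfRecord (levB : PBond (F.P K) k → ℕ) : Space115Lit F N K k Ω U₀ → NegSize (F.L : ℝ) ((F.P K).eta k) levB 0 (Matrix (Fin N) (Fin N) ℂ) :=
  fun A => (NegSup.equiv _ _).symm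
    (logOver (coeField (Averaging.iter (avOfRecord F N K) k U₀)) (iterMh k (expOver U₀ ((((F.P K).eta k : ℝ) : ℂ) • evLit F N K k Ω U₀ A)))
      - qCplxOp k U₀ (evLit F N K k Ω U₀ A))

/-- Unfolding of `COfRecord` at a bond. [cite: Balaban1985Variational, (44) p.285 (bookkeeping)] -/
theorem COfRecord_apply (levB : PBond (F.P K) k → ℕ) (A : Space115Lit F N K k Ω U₀) (c : PBond (F.P K) k) :
    NegSup.equiv _ _ (COfRecord F N K k Ω U₀ levB A) c =
      (Complex.I⁻¹ : ℂ) • mlog (iterMh k (expOver U₀ ((((F.P K).eta k : ℝ) : ℂ) • evLit F N K k Ω U₀ A)) c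
          * star (Averaging.iter (avOfRecord F N K) k U₀ c : Matrix (Fin N) (Fin N) ℂ))
        - qCplxOp k U₀ (evLit F N K k Ω U₀ A) c := rfl

omit [NeZero N] in
/-- At `A′ = 0` the chart field of `C` is the background itself. [cite: Balaban1985Variational, (15) p.280 (bookkeeping)] -/
theorem expOver_evLit_zero : expOver U₀ ((((F.P K).eta k : ℝ) : ℂ) • evLit F N K k Ω U₀ 0) = coeField U₀ := by
  rw [map_zero, smul_zero, expOver_zero]

/-- Under the small-field guard of `U₀` below `k` the holomorphic iterate at `↑U₀` is the genuine average `↑(Ū^kU₀)` (`coeField_avgFamily_eq_iterMh` re-read at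
`Averaging.iter`; bookkeeping). [cite: Balaban1987RG1, (0.4) p.253, (0.21) p.256] -/
theorem iterMh_coeField_of_smallBelow (hU₀ : SmallBelow (avOfRecord F N K) k U₀) :
    iterMh k (coeField U₀) = coeField (Averaging.iter (avOfRecord F N K) k U₀) :=
  (coeField_avgFamily_eq_iterMh hU₀).symm

/-- ★ **`C(0) = 0`** under the small-field guard of `U₀` below `k` (there `Ū^k_h(↑U₀) = ↑(Ū^kU₀)` is unitary, `log 1 = 0`, and `Q_k(U₀)0 = 0`).
[cite: Balaban1985Variational, (44) p.285; Balaban1987RG1, (0.4) p.253, (0.21) p.256] -/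
theorem COfRecord_zero (levB : PBond (F.P K) k → ℕ) (hU₀ : SmallBelow (avOfRecord F N K) k U₀) : COfRecord F N K k Ω U₀ levB 0 = 0 := by
  refine (NegSup.equiv _ _).injective (funext fun c => ?_)
  simp only [COfRecord_apply, map_zero, smul_zero, expOver_zero, iterMh_coeField_of_smallBelow F N k U₀ hU₀, coeField_apply, coe_mul_star_coe_SU,
    mlog_one, sub_zero, NegSup.equiv_zero, Pi.zero_apply]

/-- ★★ **`C` IS ℂ-ANALYTIC** at every `A′` whose chart field `exp(iη_kA′)U₀` has all its (0.4) loop matrices below `k` in the polydisc `‖W − 1‖ < 1` and whose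
relative average lies in the log-disc `‖Ū^k_h(·)(c)(Ū^kU₀)(c)⋆ − 1‖ < 1` (Sect. G: compositions of `exp`, the holomorphic averaging, `log` and linear maps).
[cite: Balaban1985Variational, Sect. G p.307, Prop. 9 p.309, (44) p.285; Balaban1985Averaging, (21) p.21, (26) p.22; Balaban1987RG1, (0.4) p.253] -/
theorem analyticAt_COfRecord [Fact (0 < (F.L : ℝ))] [Fact (0 < (F.P K).eta k)] (levB : PBond (F.P K) k → ℕ) (A : Space115Lit F N K k Ω U₀)
    (hpoly : ∀ j, j < k → ∀ (c : PBond (F.P K) (j + 1)) (i : Idx (F.P K)),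
      ‖loopMh (iterMh j (expOver U₀ ((((F.P K).eta k : ℝ) : ℂ) • evLit F N K k Ω U₀ A))) c i - 1‖ < 1)
    (hlog : ∀ c : PBond (F.P K) k,
      ‖iterMh k (expOver U₀ ((((F.P K).eta k : ℝ) : ℂ) • evLit F N K k Ω U₀ A)) c * star (Averaging.iter (avOfRecord F N K) k U₀ c : Matrix (Fin N) (Fin N) ℂ) - 1‖ < 1) :
    AnalyticAt ℂ (COfRecord F N K k Ω U₀ levB) A := by
  have hev : AnalyticAt ℂ (fun Y : Space115Lit F N K k Ω U₀ => evLit F N K k Ω U₀ Y) A :=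
    (LinearMap.toContinuousLinearMap (evLit F N K k Ω U₀)).analyticAt A
  have hX : AnalyticAt ℂ (fun Y : Space115Lit F N K k Ω U₀ => (((F.P K).eta k : ℝ) : ℂ) • evLit F N K k Ω U₀ Y) A := hev.fun_const_smul
  have hchart : AnalyticAt ℂ (fun Y : Space115Lit F N K k Ω U₀ => expOver U₀ ((((F.P K).eta k : ℝ) : ℂ) • evLit F N K k Ω U₀ Y)) A :=
    (analyticAt_expOver U₀ _).comp_of_eq hX rfl
  have hiter : AnalyticAt ℂ (fun Y : Space115Lit F N K k Ω U₀ => iterMh k (expOver U₀ ((((F.P K).eta k : ℝ) : ℂ) • evLit F N K k Ω U₀ Y))) A :=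
    (analyticAt_iterMh_of_polydisc k hpoly).comp_of_eq hchart rfl
  have hlin : AnalyticAt ℂ (fun Y : Space115Lit F N K k Ω U₀ => qCplxOp k U₀ (evLit F N K k Ω U₀ Y)) A :=
    (LinearMap.toContinuousLinearMap (qCplxOp k U₀ ∘ₗ evLit F N K k Ω U₀)).analyticAt A
  have hg : AnalyticAt ℂ (fun Y : Space115Lit F N K k Ω U₀ =>
      logOver (coeField (Averaging.iter (avOfRecord F N K) k U₀)) (iterMh k (expOver U₀ ((((F.P K).eta k : ℝ) : ℂ) • evLit F N K k Ω U₀ Y)))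
        - qCplxOp k U₀ (evLit F N K k Ω U₀ Y)) A := by
    refine AnalyticAt.fun_sub (analyticAt_pi_iff.2 fun c => ?_) hlin
    exact (analyticAt_logOver_apply (coeField (Averaging.iter (avOfRecord F N K) k U₀)) c (hlog c)).comp_of_eq hiter rfl
  exact ((NegSup.continuousLinearEquiv ℂ (V := Matrix (Fin N) (Fin N) ℂ) (levWeight (F.L : ℝ) ((F.P K).eta k) levB 0)).symm.analyticAt _).comp hg

/-- ★ **`C` IS ℂ-ANALYTIC AT `A′ = 0`** under the small-field guard of `U₀` below `k` (the loop matrices of `↑(Ū^jU₀)` are in the polydisc by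
`Node00.norm_loopM_coeField_sub_one_lt_one`, and the relative average at `0` is `1`). [cite: Balaban1985Variational, Sect. G p.307, (44) p.285; Balaban1987RG1, (0.4) p.253] -/
theorem analyticAt_COfRecord_zero [Fact (0 < (F.L : ℝ))] [Fact (0 < (F.P K).eta k)] (levB : PBond (F.P K) k → ℕ) (hU₀ : SmallBelow (avOfRecord F N K) k U₀) :
    AnalyticAt ℂ (COfRecord F N K k Ω U₀ levB) 0 := by
  refine analyticAt_COfRecord F N k Ω U₀ levB 0 (fun j hj c i => ?_) (fun c => ?_)
  · have hsb : SmallBelow (avOfRecord F N K) j U₀ := fun j' hj' c' => hU₀ j' (lt_trans hj' hj) c'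
    rw [expOver_evLit_zero, iterMh_coeField_of_smallBelow F N j U₀ hsb, loopMh_coeField]
    exact norm_loopM_coeField_sub_one_lt_one _ c (hU₀ j hj c) i
  · rw [expOver_evLit_zero, iterMh_coeField_of_smallBelow F N k U₀ hU₀, coeField_apply, coe_mul_star_coe_SU, sub_self, norm_zero]
    exact one_pos

/-- `C` is ℂ-analytic at every point of a neighbourhood of `A′ = 0` (guarded `U₀`). [cite: Balaban1985Variational, Sect. G p.307, (51)–(53) p.286] -/
theorem eventually_analyticAt_COfRecord_zero [Fact (0 < (F.L : ℝ))] [Fact (0 < (F.P K).eta k)] (levB : PBond (F.P K) k → ℕ)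
    (hU₀ : SmallBelow (avOfRecord F N K) k U₀) : ∀ᶠ A in 𝓝 (0 : Space115Lit F N K k Ω U₀), AnalyticAt ℂ (COfRecord F N K k Ω U₀ levB) A :=
  (analyticAt_COfRecord_zero F N k Ω U₀ levB hU₀).eventually_analyticAt

/-- ★ **`C` IS ℂ-DIFFERENTIABLE ON SOME BALL `{‖A′‖ < r}` about `0`** (guarded `U₀`) — the shape of the `differentiableOn` field of lit's `Prop4Hyp` ∕ `Regime`
for the successor file; the radius is NOT computed here. [cite: Balaban1985Variational, Sect. G p.307, (51)–(53) p.286, (44) p.285] -/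
theorem exists_differentiableOn_COfRecord [Fact (0 < (F.L : ℝ))] [Fact (0 < (F.P K).eta k)] (levB : PBond (F.P K) k → ℕ)
    (hU₀ : SmallBelow (avOfRecord F N K) k U₀) :
    ∃ r : ℝ, 0 < r ∧ DifferentiableOn ℂ (COfRecord F N K k Ω U₀ levB) {A : Space115Lit F N K k Ω U₀ | ‖A‖ < r} := by
  obtain ⟨r, hr, h⟩ := Metric.eventually_nhds_iff_ball.1 (eventually_analyticAt_COfRecord_zero F N k Ω U₀ levB hU₀)
  refine ⟨r, hr, fun A hA => (h A ?_).differentiableAt.differentiableWithinAt⟩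
  rw [Metric.mem_ball, dist_zero_right]
  exact hA


/-! ## §4. `C⁽²⁾` by name (56), and the letters at the unit background `U₀ = 1` (E1∕E2) -/

variable (K) in
/-- **`C⁽²⁾(A′) = ½·D²C(0)(A′, A′)` AT THE RECORD** — print's second-order part (56) of the record's constraint letter, lit's `B11Eq80Current.quadPart`
BY NAME (so that lit's `E3`∕`W80` of (78)–(80) and the `Δ⁽²⁾_π`-datum of [B9] (3.128) are one-line instantiations in files 3f′∕3g′; no formula for it is
claimed here — print's (56) expansion is NOT restated). [cite: Balaban1985Variational, (56) p.286, (78) p.290; Balaban1985BackgroundPropagators, (3.128) p.423] -/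
def C2OfRecord [Fact (0 < (F.L : ℝ))] [Fact (0 < (F.P K).eta k)] (levB : PBond (F.P K) k → ℕ) (A : Space115Lit F N K k Ω U₀) :
    NegSize (F.L : ℝ) ((F.P K).eta k) levB 0 (Matrix (Fin N) (Fin N) ℂ) :=
  B11Eq80Current.quadPart (COfRecord F N K k Ω U₀ levB) A

/-- `C⁽²⁾` unfolds to lit's `quadPart` of `C_rec` (by `rfl`). [cite: Balaban1985Variational, (56) p.286] -/
theorem C2OfRecord_eq [Fact (0 < (F.L : ℝ))] [Fact (0 < (F.P K).eta k)] (levB : PBond (F.P K) k → ℕ) (A : Space115Lit F N K k Ω U₀) :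
    C2OfRecord F N K k Ω U₀ levB A = (2 : ℂ)⁻¹ • iteratedFDeriv ℂ 2 (COfRecord F N K k Ω U₀ levB) 0 (fun _ => A) := rfl

/-- `C⁽²⁾(0) = 0` (a quadratic form vanishes at `0`). [cite: Balaban1985Variational, (56) p.286] -/
theorem C2OfRecord_zero [Fact (0 < (F.L : ℝ))] [Fact (0 < (F.P K).eta k)] (levB : PBond (F.P K) k → ℕ) :
    C2OfRecord F N K k Ω U₀ levB 0 = 0 := by
  rw [C2OfRecord_eq, show (fun _ : Fin 2 => (0 : Space115Lit F N K k Ω U₀)) = 0 from rfl, ContinuousMultilinearMap.map_zero, smul_zero]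

/-- **THE UNIT BACKGROUND IS GUARDED BELOW EVERY LEVEL** ((0.4): `Ū^j(1) = 1`, lit's `B15Claim189UnitTestAtRecord.iter_avOfRecord_one`, and the unit
configuration is small, `T3DescentFibreTower.small_one`) — a genuine RESTATEMENT, Literature-side, of the cell's Summit-side twins
`Summit.…BalabanUVNodes.N12FlatChartDerivIterLin.smallBelow_avOfRecord_one` ∕ `…N07ChartLineFactsS1.smallBelow_one` (not importable here), stated so that the
E2 instances below live next to the letters. [cite: Balaban1987RG1, (0.4) p.253 (bookkeeping)] -/
theorem smallBelow_avOfRecord_one : SmallBelow (avOfRecord F N K) k (1 : GaugeField (F.P K) 0 (SU N)) := fun j _ c => by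
  rw [B15Claim189UnitTestAtRecord.iter_avOfRecord_one F N K j]
  exact T3DescentFibreTower.small_one _ c

/-- E1 for `B`: at the unit background `B(V)(c) = (1/i) log V(c)` ((20) with `Ū^k 1 = 1`). [cite: Balaban1985Variational, (20) p.281] -/
theorem BOfRecord_one_apply (levB : PBond (F.P K) k → ℕ) (V : GaugeField (F.P K) k (SU N)) (c : PBond (F.P K) k) :
    NegSup.equiv _ _ (BOfRecord F N K k 1 levB V) c = (Complex.I⁻¹ : ℂ) • mlog (V c : Matrix (Fin N) (Fin N) ℂ) := by
  rw [BOfRecord_apply, B15Claim189UnitTestAtRecord.iter_avOfRecord_one F N K k, show (1 : GaugeField (F.P K) k (SU N)) c = 1 from rfl,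
    OneMemClass.coe_one, star_one, mul_one]

/-- E2 for `B`: at `(U₀, V) = (1, 1)` the constraint letter vanishes, `B(1) = 0`. [cite: Balaban1985Variational, (20) p.281, (3) p.278] -/
theorem BOfRecord_one_one (levB : PBond (F.P K) k → ℕ) : BOfRecord F N K k (1 : GaugeField (F.P K) 0 (SU N)) levB 1 = 0 := by
  have h := BOfRecord_self F N k (1 : GaugeField (F.P K) 0 (SU N)) levB
  rwa [B15Claim189UnitTestAtRecord.iter_avOfRecord_one F N K k] at h

/-- E2 for `𝔄`: at `(U₀, V) = (1, 1)`, `𝔄(1) = H₁B(1) = 0` (the hypotheses `hpos`, `hQ` at `U₀ = 1` are the cell's Summit-side theorems on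
`laplaceAOfRecord … 1` ∕ `QOfRecord … 1`, displayed here, not imported). [cite: Balaban1985Variational, (103) p.293, (20) p.281] -/
theorem frakAOfRecordAtBgFlat_one_one [Fact (0 < (F.L : ℝ))] [Fact (0 < (F.P K).eta k)] [Fact (0 < c0Rec F K k)] [Fact (∀ c, 0 < wBRec F K k c)]
    (levB : PBond (F.P K) k → ℕ) (a : ℝ)
    (hpos : ∀ x, x ≠ 0 → 0 < RCLike.re ⟪x, laplaceAOfRecord F N k 1 (QOfRecord F N k 1) (QflatOfRecord F N k) a x⟫_ℂ)
    (hQ : Function.Surjective (QOfRecord F N k (1 : GaugeField (F.P K) 0 (SU N)))) :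
    frakAOfRecordAtBgFlat F N K k Ω 1 levB a hpos hQ 1 = 0 := by
  rw [frakAOfRecordAtBgFlat_eq, BOfRecord_one_one, map_zero]

/-- E1 for `C`: at the unit background `C(A′)(c) = (1/i) log Ū^k_h(exp(iη_kA′))(c) − (Q_k(1)A′)(c)` ((44) at `U₀ = 1`, `Ū^k 1 = 1`).
[cite: Balaban1985Variational, (44) p.285, (20) p.281] -/
theorem COfRecord_one_apply (levB : PBond (F.P K) k → ℕ) (A : Space115Lit F N K k Ω 1) (c : PBond (F.P K) k) :
    NegSup.equiv _ _ (COfRecord F N K k Ω 1 levB A) c =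
      (Complex.I⁻¹ : ℂ) • mlog (iterMh k (fun b => exp (Complex.I • ((((F.P K).eta k : ℝ) : ℂ) • evLit F N K k Ω 1 A) b)) c)
        - qCplxOp k 1 (evLit F N K k Ω 1 A) c := by
  rw [COfRecord_apply, expOver_one, B15Claim189UnitTestAtRecord.iter_avOfRecord_one F N K k, show (1 : GaugeField (F.P K) k (SU N)) c = 1 from rfl,
    OneMemClass.coe_one, star_one, mul_one]

/-- E2 for `C`: `C(0) = 0` at the unit background, unconditionally (the guard is `smallBelow_avOfRecord_one`). [cite: Balaban1985Variational, (44) p.285] -/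
theorem COfRecord_one_zero (levB : PBond (F.P K) k → ℕ) : COfRecord F N K k Ω (1 : GaugeField (F.P K) 0 (SU N)) levB 0 = 0 :=
  COfRecord_zero F N k Ω 1 levB (smallBelow_avOfRecord_one F N k)

/-- E2 for the holomorphy of `C`: at the unit background `C` is analytic at `A′ = 0`, unconditionally. [cite: Balaban1985Variational, (44) p.285, Prop. 4 p.286] -/
theorem analyticAt_COfRecord_one_zero [Fact (0 < (F.L : ℝ))] [Fact (0 < (F.P K).eta k)] (levB : PBond (F.P K) k → ℕ) :
    AnalyticAt ℂ (COfRecord F N K k Ω (1 : GaugeField (F.P K) 0 (SU N)) levB) 0 :=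
  analyticAt_COfRecord_zero F N k Ω 1 levB (smallBelow_avOfRecord_one F N k)

/-- E2: at the unit background `C` is complex-differentiable on a ball `‖A′‖ < r`, `r > 0`, unconditionally. [cite: Balaban1985Variational, Prop. 4 p.286] -/
theorem exists_differentiableOn_COfRecord_one [Fact (0 < (F.L : ℝ))] [Fact (0 < (F.P K).eta k)] (levB : PBond (F.P K) k → ℕ) :
    ∃ r : ℝ, 0 < r ∧ DifferentiableOn ℂ (COfRecord F N K k Ω (1 : GaugeField (F.P K) 0 (SU N)) levB) {A : Space115Lit F N K k Ω 1 | ‖A‖ < r} :=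
  exists_differentiableOn_COfRecord F N k Ω 1 levB (smallBelow_avOfRecord_one F N k)

end Record

end Literature.MathematicalPhysics.QuantumFieldTheory.Balaban1983to89.Node00

end
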